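import Mathlib
import Summits.NavierStokesRegularity.NavierStokesRegularity.Theorems.WakeRatchetTailRatchet.Negative.TailRatchetFalseOfDyadicScalarFronts
import Summits.NavierStokesRegularity.NavierStokesRegularity.Theorems.WakeRatchetEternalViscousRate.Negative.EternalViscousRateFalseOfViscousBlockDSSWaves
import HarnessLib

/-!
# `WakeRatchet.TailRatchet` (stmt-NavierStokesRegularity-21808): the registered line `birth` —
# its three stubs BY NAME against the crux, the live rate children, and the two constructions

The registered skeleton `Cruxes/TailRatchet/Lines/birth.lean` (sha16 `d00b85951d7cfa9f`) splits the rev-0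
crux `TailRatchet` (ε₀-UNIFORM per-shell contraction `Θ_{n+1} ≤ (1 − w(R))·Θ_n` of the tail-energy envelopes
of every uniformly bounded admissible eternal solution of every E₂(R) table) by dissipation level:
`stub_inviscid` (ν̂ = 0), `stub_viscous` (ν̂ > 0) — composed to the crux by `tailRatchet_from` — and the
plan-only rung `stub_rung_dss` (the inviscid stub on shell-self-similar solutions `W_{n+1}(σ) = W_n(σ − T)`).
This file records, kernel-checked and with every stub statement QUOTED VERBATIM, where each stub stands:

* LOGIC OF THE LINE: `tailRatchet_iff_stubs : TailRatchet ↔ stub_inviscid ∧ stub_viscous` (the split is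
  lossless), `stubRungDss_of_stubInviscid` (the rung is a sub-case of the inviscid stub);
* AGAINST THE LIVE ITEMS: `eternalInviscidRate_of_stubInviscid : stub_inviscid → EternalInviscidRate`
  (stmt-25646) and `eternalViscousRate_of_stubViscous : stub_viscous → EternalViscousRate` (stmt-25647), both
  with rate `a = 2` — the rev-0 stubs are STRONGER than the repaired rate children (same elementary
  inequality `1 − w ≤ (1+ε₀)^{-2}` for `ε₀ ≤ w/2` as the tree's `rateRatchet_of_tailRatchet`);
* AGAINST THE CONSTRUCTIONS (negative lemmas, no verdict change):
  `stubInviscid_false_of_DyadicScalarFronts`, `stubRungDss_false_of_DyadicScalarFronts` — ONE scalar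
  front profile of the inviscid dyadic chain at arbitrarily small scale ratios (the construction item
  `WakeRatchetDyadicFront.DyadicScalarFronts`, p589335) kills both inviscid-side stubs, through the tree's
  dictionary `isDSSWave_dyadic_of_scalarFront` and kill criteria `stubInviscid_false_of_persistentDSSWaves` /
  `not_dssRung_of_persistent_fronts`; and `stubViscous_false_of_ViscousBlockDSSWaves` — a non-trivial
  bounded block-self-similar admissible eternal solution with positive covariant viscosity
  (`WakeRatchetViscDSS.ViscousBlockDSSWaves`, whose lag is pinned to `e^T = (1+ε₀)^{2p} > 1`,
  `viscBlockDSS_lag`) kills the viscous stub through `trivial_of_contraction_visc`; hence also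
  `tailRatchet_false_of_ViscousBlockDSSWaves`.

So the line `birth` is dead modulo exactly the two constructions the crux itself is dead modulo; no stub
of it is provable unless BOTH constructions fail (each stub is a Liouville statement for the corresponding
class of exact self-similar blow-up profiles below threshold).

HONEST FRAMING: bookkeeping about MODEL lattice ODEs (Tao 2016 §4 in the renormalised variables of §6.4);
nothing here is a statement about the Navier–Stokes equations; no item is closed and no verdict changes.
-/

noncomputable section

set_option linter.dupNamespace false

namespace Summit.NavierStokesRegularity.NavierStokesRegularity.Theorems

namespace WakeRatchetBirthStubs

open Literature.Analysis.FluidPDE Literature.Analysis.FluidPDE.TaoCascade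
open Summit.NavierStokesRegularity.NavierStokesRegularity.Theses.WakeRatchet
open WakeRatchetDSS WakeRatchetTailRatchetNegative WakeRatchetDyadicFront WakeRatchetViscDSS

/-! ## The logic of the line: the dissipation split is lossless, the rung is a sub-case -/

/-- **Composition of the line** (the skeleton's `tailRatchet_from`, restated in the tree): the inviscid stub
and the viscous stub give the crux, with `w := min w₀ w₁`, `εs := min`, by the case split
`IsEternalVisc.nonneg` / `isEternalVisc_zero_iff`.
[cite: Tao2016AveragedNS, §4 Thm. 4.2 (statement shape) and the viscous equation before it, §6.4; cell vocabulary] -/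
theorem tailRatchet_of_stubs
    (h0 : ∀ R : ℝ, 1 ≤ R → ∃ w : ℝ, 0 < w ∧ ∃ εs : ℝ, 0 < εs ∧ ∀ ε₀ : ℝ, 0 < ε₀ → ε₀ ≤ εs →
      ∀ α : Fin 4 → Fin 4 → Fin 4 → ℤ × ℤ × ℤ → ℝ, InTableClass R α →
        ∀ W : ℤ → ℝ → Em 4, IsEternal ε₀ α W → UniformBound W →
          ∀ (n : ℤ) (M : ℝ), (∀ σ : ℝ, ∑' k : ℕ, physEnergy ε₀ W (n + k) σ ≤ M) →
            ∀ σ : ℝ, ∑' k : ℕ, physEnergy ε₀ W (n + 1 + k) σ ≤ (1 - w) * M)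
    (h1 : ∀ R : ℝ, 1 ≤ R → ∃ w : ℝ, 0 < w ∧ ∃ εs : ℝ, 0 < εs ∧ ∀ ε₀ : ℝ, 0 < ε₀ → ε₀ ≤ εs →
      ∀ α : Fin 4 → Fin 4 → Fin 4 → ℤ × ℤ × ℤ → ℝ, InTableClass R α →
        ∀ (νh : ℝ) (W : ℤ → ℝ → Em 4), 0 < νh → IsEternalVisc ε₀ νh α W → UniformBound W →
          ∀ (n : ℤ) (M : ℝ), (∀ σ : ℝ, ∑' k : ℕ, physEnergy ε₀ W (n + k) σ ≤ M) →
            ∀ σ : ℝ, ∑' k : ℕ, physEnergy ε₀ W (n + 1 + k) σ ≤ (1 - w) * M) :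
    TailRatchet := by
  intro R hR
  obtain ⟨w₀, hw₀, ε₀s, hε₀s, H₀⟩ := h0 R hR
  obtain ⟨w₁, hw₁, ε₁s, hε₁s, H₁⟩ := h1 R hR
  refine ⟨min w₀ w₁, lt_min hw₀ hw₁, min ε₀s ε₁s, lt_min hε₀s hε₁s, ?_⟩
  intro ε₀ hε₀ hle α hα νh W hW hU n M hM σ
  have hM0 : 0 ≤ M :=
    le_trans (tsum_nonneg fun k : ℕ => physEnergy_nonneg ε₀ W (n + (k : ℤ)) σ) (hM σ)
  rcases hW.nonneg.eq_or_lt with hν | hν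
  · have hW' : IsEternal ε₀ α W := isEternalVisc_zero_iff.1 (hν ▸ hW)
    have := H₀ ε₀ hε₀ (hle.trans (min_le_left _ _)) α hα W hW' hU n M hM σ
    refine this.trans (mul_le_mul_of_nonneg_right ?_ hM0)
    linarith [min_le_left w₀ w₁]
  · have := H₁ ε₀ hε₀ (hle.trans (min_le_right _ _)) α hα νh W hν hW hU n M hM σ
    refine this.trans (mul_le_mul_of_nonneg_right ?_ hM0)
    linarith [min_le_right w₀ w₁]

/-- **Crux ⟹ inviscid stub** (`stub_inviscid` quoted verbatim): the `ν̂ = 0` slice, via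
`IsEternal.isEternalVisc`. [cite: Tao2016AveragedNS, §4 Lemma 4.1 (iii) (4.8), §6.4; cell vocabulary] -/
theorem stubInviscid_of_tailRatchet (h : TailRatchet) :
    ∀ R : ℝ, 1 ≤ R → ∃ w : ℝ, 0 < w ∧ ∃ εs : ℝ, 0 < εs ∧ ∀ ε₀ : ℝ, 0 < ε₀ → ε₀ ≤ εs →
      ∀ α : Fin 4 → Fin 4 → Fin 4 → ℤ × ℤ × ℤ → ℝ, InTableClass R α →
        ∀ W : ℤ → ℝ → Em 4, IsEternal ε₀ α W → UniformBound W →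
          ∀ (n : ℤ) (M : ℝ), (∀ σ : ℝ, ∑' k : ℕ, physEnergy ε₀ W (n + k) σ ≤ M) →
            ∀ σ : ℝ, ∑' k : ℕ, physEnergy ε₀ W (n + 1 + k) σ ≤ (1 - w) * M := by
  intro R hR
  obtain ⟨w, hw, εs, hεs, H⟩ := h R hR
  exact ⟨w, hw, εs, hεs, fun ε₀ hε₀ hle α hα W hW hU => H ε₀ hε₀ hle α hα 0 W hW.isEternalVisc hU⟩

/-- **Crux ⟹ viscous stub** (`stub_viscous` quoted verbatim): the `ν̂ > 0` slice (forget `0 < ν̂`).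
[cite: Tao2016AveragedNS, §4, the viscous equation before Thm. 4.2, §6.4; cell vocabulary] -/
theorem stubViscous_of_tailRatchet (h : TailRatchet) :
    ∀ R : ℝ, 1 ≤ R → ∃ w : ℝ, 0 < w ∧ ∃ εs : ℝ, 0 < εs ∧ ∀ ε₀ : ℝ, 0 < ε₀ → ε₀ ≤ εs →
      ∀ α : Fin 4 → Fin 4 → Fin 4 → ℤ × ℤ × ℤ → ℝ, InTableClass R α →
        ∀ (νh : ℝ) (W : ℤ → ℝ → Em 4), 0 < νh → IsEternalVisc ε₀ νh α W → UniformBound W →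
          ∀ (n : ℤ) (M : ℝ), (∀ σ : ℝ, ∑' k : ℕ, physEnergy ε₀ W (n + k) σ ≤ M) →
            ∀ σ : ℝ, ∑' k : ℕ, physEnergy ε₀ W (n + 1 + k) σ ≤ (1 - w) * M := by
  intro R hR
  obtain ⟨w, hw, εs, hεs, H⟩ := h R hR
  exact ⟨w, hw, εs, hεs, fun ε₀ hε₀ hle α hα νh W _ hW hU => H ε₀ hε₀ hle α hα νh W hW hU⟩

/-- **The dissipation split of the line is lossless**: `TailRatchet ↔ stub_inviscid ∧ stub_viscous`.
[cite: Tao2016AveragedNS, §4 Thm. 4.2 (statement shape), §6.4; cell vocabulary] -/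
theorem tailRatchet_iff_stubs :
    TailRatchet ↔
      ((∀ R : ℝ, 1 ≤ R → ∃ w : ℝ, 0 < w ∧ ∃ εs : ℝ, 0 < εs ∧ ∀ ε₀ : ℝ, 0 < ε₀ → ε₀ ≤ εs →
        ∀ α : Fin 4 → Fin 4 → Fin 4 → ℤ × ℤ × ℤ → ℝ, InTableClass R α →
          ∀ W : ℤ → ℝ → Em 4, IsEternal ε₀ α W → UniformBound W →
            ∀ (n : ℤ) (M : ℝ), (∀ σ : ℝ, ∑' k : ℕ, physEnergy ε₀ W (n + k) σ ≤ M) →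
              ∀ σ : ℝ, ∑' k : ℕ, physEnergy ε₀ W (n + 1 + k) σ ≤ (1 - w) * M) ∧
      (∀ R : ℝ, 1 ≤ R → ∃ w : ℝ, 0 < w ∧ ∃ εs : ℝ, 0 < εs ∧ ∀ ε₀ : ℝ, 0 < ε₀ → ε₀ ≤ εs →
        ∀ α : Fin 4 → Fin 4 → Fin 4 → ℤ × ℤ × ℤ → ℝ, InTableClass R α →
          ∀ (νh : ℝ) (W : ℤ → ℝ → Em 4), 0 < νh → IsEternalVisc ε₀ νh α W → UniformBound W →
            ∀ (n : ℤ) (M : ℝ), (∀ σ : ℝ, ∑' k : ℕ, physEnergy ε₀ W (n + k) σ ≤ M) →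
              ∀ σ : ℝ, ∑' k : ℕ, physEnergy ε₀ W (n + 1 + k) σ ≤ (1 - w) * M)) :=
  ⟨fun h => ⟨stubInviscid_of_tailRatchet h, stubViscous_of_tailRatchet h⟩,
    fun h => tailRatchet_of_stubs h.1 h.2⟩

/-- **The rung is a sub-case of the inviscid stub**: `stub_inviscid ⟹ stub_rung_dss` (both quoted verbatim;
the shell-self-similarity hypothesis is simply dropped).
[cite: Tao2016AveragedNS, §4 Lemma 4.1 (iii) (4.8), §6.4; cell vocabulary] -/
theorem stubRungDss_of_stubInviscid
    (h : ∀ R : ℝ, 1 ≤ R → ∃ w : ℝ, 0 < w ∧ ∃ εs : ℝ, 0 < εs ∧ ∀ ε₀ : ℝ, 0 < ε₀ → ε₀ ≤ εs →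
      ∀ α : Fin 4 → Fin 4 → Fin 4 → ℤ × ℤ × ℤ → ℝ, InTableClass R α →
        ∀ W : ℤ → ℝ → Em 4, IsEternal ε₀ α W → UniformBound W →
          ∀ (n : ℤ) (M : ℝ), (∀ σ : ℝ, ∑' k : ℕ, physEnergy ε₀ W (n + k) σ ≤ M) →
            ∀ σ : ℝ, ∑' k : ℕ, physEnergy ε₀ W (n + 1 + k) σ ≤ (1 - w) * M) :
    ∀ R : ℝ, 1 ≤ R → ∃ w : ℝ, 0 < w ∧ ∃ εs : ℝ, 0 < εs ∧ ∀ ε₀ : ℝ, 0 < ε₀ → ε₀ ≤ εs →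
      ∀ α : Fin 4 → Fin 4 → Fin 4 → ℤ × ℤ × ℤ → ℝ, InTableClass R α →
        ∀ (W : ℤ → ℝ → Em 4) (T : ℝ), IsEternal ε₀ α W → UniformBound W →
          (∀ (n : ℤ) (σ : ℝ), W (n + 1) σ = W n (σ - T)) →
          ∀ (n : ℤ) (M : ℝ), (∀ σ : ℝ, ∑' k : ℕ, physEnergy ε₀ W (n + k) σ ≤ M) →
            ∀ σ : ℝ, ∑' k : ℕ, physEnergy ε₀ W (n + 1 + k) σ ≤ (1 - w) * M := by
  intro R hR
  obtain ⟨w, hw, εs, hεs, H⟩ := h R hR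
  exact ⟨w, hw, εs, hεs, fun ε₀ hε₀ hle α hα W _ hW hU _ => H ε₀ hε₀ hle α hα W hW hU⟩

/-! ## Against the live rate children (stmt-25646 / stmt-25647): the rev-0 stubs are stronger -/

/-- The elementary rate inequality: for `0 < ε₀ ≤ w/2`, `1 − w ≤ (1+ε₀)^{-2}`
(`(1 − w)(1 + w/2)² = 1 − ¾w² − ¼w³ ≤ 1`). [folklore] -/
theorem one_sub_le_rpow_neg_two {ε₀ w : ℝ} (hε : 0 < ε₀) (hw : 0 < w) (hεw : ε₀ ≤ w / 2) :
    1 - w ≤ (1 + ε₀) ^ (-(2 : ℝ)) := by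
  have hb0 : 0 < 1 + ε₀ := by linarith
  have e : (1 + ε₀) ^ (-(2 : ℝ)) = ((1 + ε₀) ^ 2)⁻¹ := by
    rw [Real.rpow_neg hb0.le, show (2 : ℝ) = ((2 : ℕ) : ℝ) by norm_num, Real.rpow_natCast]
  have hpos : 0 < (1 + ε₀) ^ 2 := by positivity
  have key : (1 - w) * (1 + ε₀) ^ 2 ≤ 1 := by
    rcases le_or_gt w 1 with hw1 | hw1
    · have hsq : (1 + ε₀) ^ 2 ≤ (1 + w / 2) ^ 2 := pow_le_pow_left₀ hb0.le (by linarith) 2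
      have h2 : (1 - w) * (1 + ε₀) ^ 2 ≤ (1 - w) * (1 + w / 2) ^ 2 :=
        mul_le_mul_of_nonneg_left hsq (by linarith)
      nlinarith [sq_nonneg w, hw.le]
    · nlinarith [hpos]
  rw [e, ← one_div]
  exact (le_div_iff₀ hpos).2 key

/-- **`stub_inviscid ⟹ EternalInviscidRate`** (stmt-NavierStokesRegularity-25646) with rate `a = 2`
(threshold shrunk to `ε₀ ≤ w/2`). [cite: Tao2016AveragedNS, §4 Thm. 4.2 (statement shape), §6.4; cell vocabulary] -/
theorem eternalInviscidRate_of_stubInviscid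
    (h : ∀ R : ℝ, 1 ≤ R → ∃ w : ℝ, 0 < w ∧ ∃ εs : ℝ, 0 < εs ∧ ∀ ε₀ : ℝ, 0 < ε₀ → ε₀ ≤ εs →
      ∀ α : Fin 4 → Fin 4 → Fin 4 → ℤ × ℤ × ℤ → ℝ, InTableClass R α →
        ∀ W : ℤ → ℝ → Em 4, IsEternal ε₀ α W → UniformBound W →
          ∀ (n : ℤ) (M : ℝ), (∀ σ : ℝ, ∑' k : ℕ, physEnergy ε₀ W (n + k) σ ≤ M) →
            ∀ σ : ℝ, ∑' k : ℕ, physEnergy ε₀ W (n + 1 + k) σ ≤ (1 - w) * M) :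
    EternalInviscidRate := by
  intro R hR
  obtain ⟨w, hw, εs, hεs, H⟩ := h R hR
  refine ⟨2, by norm_num, min εs (w / 2), lt_min hεs (by positivity), ?_⟩
  intro ε₀ hε₀ hle α hα W hW hU n M hM σ
  have hM0 : 0 ≤ M :=
    (tsum_nonneg fun k : ℕ => physEnergy_nonneg ε₀ W (n + (k : ℤ)) σ).trans (hM σ)
  have h1 := H ε₀ hε₀ (hle.trans (min_le_left _ _)) α hα W hW hU n M hM σ
  exact h1.trans (mul_le_mul_of_nonneg_right
    (one_sub_le_rpow_neg_two hε₀ hw (hle.trans (min_le_right _ _))) hM0)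

/-- **`stub_viscous ⟹ EternalViscousRate`** (stmt-NavierStokesRegularity-25647) with rate `a = 2`.
[cite: Tao2016AveragedNS, §4, the viscous equation before Thm. 4.2, §6.4; cell vocabulary] -/
theorem eternalViscousRate_of_stubViscous
    (h : ∀ R : ℝ, 1 ≤ R → ∃ w : ℝ, 0 < w ∧ ∃ εs : ℝ, 0 < εs ∧ ∀ ε₀ : ℝ, 0 < ε₀ → ε₀ ≤ εs →
      ∀ α : Fin 4 → Fin 4 → Fin 4 → ℤ × ℤ × ℤ → ℝ, InTableClass R α →
        ∀ (νh : ℝ) (W : ℤ → ℝ → Em 4), 0 < νh → IsEternalVisc ε₀ νh α W → UniformBound W →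
          ∀ (n : ℤ) (M : ℝ), (∀ σ : ℝ, ∑' k : ℕ, physEnergy ε₀ W (n + k) σ ≤ M) →
            ∀ σ : ℝ, ∑' k : ℕ, physEnergy ε₀ W (n + 1 + k) σ ≤ (1 - w) * M) :
    EternalViscousRate := by
  intro R hR
  obtain ⟨w, hw, εs, hεs, H⟩ := h R hR
  refine ⟨2, by norm_num, min εs (w / 2), lt_min hεs (by positivity), ?_⟩
  intro ε₀ hε₀ hle α hα νh W hν hW hU n M hM σ
  have hM0 : 0 ≤ M :=
    (tsum_nonneg fun k : ℕ => physEnergy_nonneg ε₀ W (n + (k : ℤ)) σ).trans (hM σ)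
  have h1 := H ε₀ hε₀ (hle.trans (min_le_left _ _)) α hα νh W hν hW hU n M hM σ
  exact h1.trans (mul_le_mul_of_nonneg_right
    (one_sub_le_rpow_neg_two hε₀ hw (hle.trans (min_le_right _ _))) hM0)

/-! ## Against the constructions: every stub is dead modulo what the crux is dead modulo -/

/-- The scalar front family of `DyadicScalarFronts` as a persistent family of admissible non-trivial
SINGLE-PROFILE DSS waves of the dyadic member (the dictionary `isDSSWave_dyadic_of_scalarFront`, packaged in
the shape consumed by the tree's kill criteria). [cite: Tao2016AveragedNS, §1.2 (dyadic model), §4; cell vocabulary] -/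
theorem dyadicFronts_of_DyadicScalarFronts (hF : DyadicScalarFronts) :
    ∀ ε : ℝ, 0 < ε → ∃ ε₀ : ℝ, 0 < ε₀ ∧ ε₀ ≤ ε ∧
      ∃ α : Fin 4 → Fin 4 → Fin 4 → ℤ × ℤ × ℤ → ℝ, InTableClass 2 α ∧
        ∃ (T : ℝ) (Φ : Fin 1 → ℝ → Em 4), IsDSSWave ε₀ α 1 T Φ ∧ ∃ x, Φ 0 x ≠ 0 := by
  intro ε hε
  obtain ⟨ε₀, hε₀, hle, s, hs, a, hode, hint, hbdd, t₁, ht₁, hne⟩ := hF ε hε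
  refine ⟨ε₀, hε₀, hle, dyadicTable, inTableClass_dyadicTable le_rfl, Real.log s, _,
    isDSSWave_dyadic_of_scalarFront hε₀ hs hode hint hbdd, -Real.log (-t₁), ?_⟩
  have ht : -Real.exp (-(-Real.log (-t₁))) = t₁ := by
    rw [neg_neg, Real.exp_log (neg_pos.2 ht₁), neg_neg]
  rw [ht]
  have hpos : Real.exp (-(-Real.log (-t₁))) ≠ 0 := (Real.exp_pos _).ne'
  intro h0
  rw [smul_eq_zero] at h0
  rcases h0 with h0 | h0
  · exact (mul_ne_zero hpos hne) h0
  · exact one_ne_zero ((PiLp.single_eq_zero_iff 2 (0 : Fin 4)).1 h0)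

/-- **Negative lemma for the registered stub `stub_inviscid`: `DyadicScalarFronts → ¬ stub_inviscid`**
(statement quoted verbatim).  One scalar front profile of the inviscid dyadic chain at arbitrarily small
scale ratios is an admissible non-trivial DSS wave of `dyadicTable ∈ E₂(2)`, which the inviscid stub forbids
below its threshold (`stubInviscid_false_of_persistentDSSWaves`).
[cite: Tao2016AveragedNS, §1.2, §4; cell vocabulary (stmt-NavierStokesRegularity-21808, line `birth`)] -/
theorem stubInviscid_false_of_DyadicScalarFronts (hF : DyadicScalarFronts) :
    ¬ (∀ R : ℝ, 1 ≤ R → ∃ w : ℝ, 0 < w ∧ ∃ εs : ℝ, 0 < εs ∧ ∀ ε₀ : ℝ, 0 < ε₀ → ε₀ ≤ εs →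
      ∀ α : Fin 4 → Fin 4 → Fin 4 → ℤ × ℤ × ℤ → ℝ, InTableClass R α →
        ∀ W : ℤ → ℝ → Em 4, IsEternal ε₀ α W → UniformBound W →
          ∀ (n : ℤ) (M : ℝ), (∀ σ : ℝ, ∑' k : ℕ, physEnergy ε₀ W (n + k) σ ≤ M) →
            ∀ σ : ℝ, ∑' k : ℕ, physEnergy ε₀ W (n + 1 + k) σ ≤ (1 - w) * M) := by
  refine stubInviscid_false_of_persistentDSSWaves (R := 2) (by norm_num) fun ε hε => ?_
  obtain ⟨ε₀, hε₀, hle, α, hα, T, Φ, hW, x, hne⟩ := dyadicFronts_of_DyadicScalarFronts hF ε hε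
  exact ⟨ε₀, hε₀, hle, α, hα, 1, 1, T, Φ, hW, 0, x, hne⟩

/-- **Negative lemma for the registered rung `stub_rung_dss`: `DyadicScalarFronts → ¬ stub_rung_dss`**
(statement quoted verbatim).  The scalar front is a SINGLE-PROFILE wave (`q = 1`, trivial shape
permutation), exactly the shape the rung's kill criterion `not_dssRung_of_persistent_fronts` consumes.
[cite: Tao2016AveragedNS, §1.2, §4; cell vocabulary (stmt-NavierStokesRegularity-21808, line `birth`)] -/
theorem stubRungDss_false_of_DyadicScalarFronts (hF : DyadicScalarFronts) :
    ¬ (∀ R : ℝ, 1 ≤ R → ∃ w : ℝ, 0 < w ∧ ∃ εs : ℝ, 0 < εs ∧ ∀ ε₀ : ℝ, 0 < ε₀ → ε₀ ≤ εs →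
      ∀ α : Fin 4 → Fin 4 → Fin 4 → ℤ × ℤ × ℤ → ℝ, InTableClass R α →
        ∀ (W : ℤ → ℝ → Em 4) (T : ℝ), IsEternal ε₀ α W → UniformBound W →
          (∀ (n : ℤ) (σ : ℝ), W (n + 1) σ = W n (σ - T)) →
          ∀ (n : ℤ) (M : ℝ), (∀ σ : ℝ, ∑' k : ℕ, physEnergy ε₀ W (n + k) σ ≤ M) →
            ∀ σ : ℝ, ∑' k : ℕ, physEnergy ε₀ W (n + 1 + k) σ ≤ (1 - w) * M) :=
  not_dssRung_of_persistent_fronts (R := 2) (by norm_num) (dyadicFronts_of_DyadicScalarFronts hF)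

/-- **Negative lemma for the registered stub `stub_viscous`: `ViscousBlockDSSWaves → ¬ stub_viscous`**
(statement quoted verbatim).  A non-trivial uniformly bounded block-self-similar admissible eternal solution
with covariant viscosity `ν̂ > 0` has its lag pinned to `e^T = (1+ε₀)^{2p} > 1` (`viscBlockDSS_lag`), hence
a POSITIVE lag, and below the stub's threshold (shrunk to `(1+ε₀)^5(1 − w) ≤ 1`) the contraction forces it
to vanish (`trivial_of_contraction_visc`).
[cite: Tao2016AveragedNS, §4, the viscous equation before Thm. 4.2, §6.4; cell vocabulary (stmt-NavierStokesRegularity-21808, line `birth`)] -/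
theorem stubViscous_false_of_ViscousBlockDSSWaves (hF : ViscousBlockDSSWaves) :
    ¬ (∀ R : ℝ, 1 ≤ R → ∃ w : ℝ, 0 < w ∧ ∃ εs : ℝ, 0 < εs ∧ ∀ ε₀ : ℝ, 0 < ε₀ → ε₀ ≤ εs →
      ∀ α : Fin 4 → Fin 4 → Fin 4 → ℤ × ℤ × ℤ → ℝ, InTableClass R α →
        ∀ (νh : ℝ) (W : ℤ → ℝ → Em 4), 0 < νh → IsEternalVisc ε₀ νh α W → UniformBound W →
          ∀ (n : ℤ) (M : ℝ), (∀ σ : ℝ, ∑' k : ℕ, physEnergy ε₀ W (n + k) σ ≤ M) →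
            ∀ σ : ℝ, ∑' k : ℕ, physEnergy ε₀ W (n + 1 + k) σ ≤ (1 - w) * M) := by
  intro h
  obtain ⟨R, hR, H⟩ := hF
  obtain ⟨w, hw, εs, hεs, Hw⟩ := h R hR
  -- shrink the rate and the threshold as in `threshold_visc_of_tailRatchet`
  set w' : ℝ := min w (1 / 2) with hw'
  have hw'1 : w' ≤ 1 := (min_le_right _ _).trans (by norm_num)
  have hw'0 : 0 < w' := lt_min hw (by norm_num)
  obtain ⟨ε₀, hε₀, hle, α, hα, νh, W, p, T, hν, hp, hW, hU, hD, n₀, σ₀, hne⟩ :=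
    H (min εs (w' / 5)) (lt_min hεs (by positivity))
  have hthr : (1 + ε₀) ^ 5 * (1 - w') ≤ 1 :=
    pow_five_mul_sub_le_one hw'1 hε₀.le (hle.trans (min_le_right _ _))
  -- the lag of a non-trivial viscous block-DSS solution is positive
  have hlag := viscBlockDSS_lag (by linarith) hν hW hD hne
  have hT : 0 < T := by
    have hb : 1 < (1 + ε₀) ^ 2 := by nlinarith
    have h1 : 1 < ((1 + ε₀) ^ 2) ^ p := one_lt_pow₀ hb hp.ne'
    rw [← hlag] at h1
    exact Real.exp_lt_exp.mp (by rwa [Real.exp_zero])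
  -- contraction at the weakened rate along `W`
  have hC : ∀ (n : ℤ) (M : ℝ), (∀ σ : ℝ, ∑' k : ℕ, physEnergy ε₀ W (n + k) σ ≤ M) →
      ∀ σ : ℝ, ∑' k : ℕ, physEnergy ε₀ W (n + 1 + k) σ ≤ (1 - w') * M := by
    intro n M hM σ
    have hM0 : 0 ≤ M :=
      (tsum_nonneg fun k : ℕ => physEnergy_nonneg ε₀ W (n + (k : ℤ)) σ).trans (hM σ)
    have h1 := Hw ε₀ hε₀ (hle.trans (min_le_left _ _)) α hα νh W hν hW hU n M hM σ
    exact h1.trans (mul_le_mul_of_nonneg_right (by linarith [min_le_left w (1 / 2)]) hM0)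
  exact hne (trivial_of_contraction_visc hε₀ hα.2.1 hW hU hT hw'1 hthr hD hC n₀ σ₀)

/-- **Corollary: `ViscousBlockDSSWaves → ¬ TailRatchet`** by name (the crux binds `ν̂ > 0` through its
viscous stub). [cite: Tao2016AveragedNS, §4, §6.4; cell vocabulary (stmt-NavierStokesRegularity-21808)] -/
theorem tailRatchet_false_of_ViscousBlockDSSWaves (hF : ViscousBlockDSSWaves) : ¬ TailRatchet :=
  fun h => stubViscous_false_of_ViscousBlockDSSWaves hF (stubViscous_of_tailRatchet h)

/-- **Summary: the line `birth` needs BOTH constructions to fail.**  If either the scalar dyadic front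
(`DyadicScalarFronts`) or a dissipation-balanced block-DSS profile (`ViscousBlockDSSWaves`) exists, the crux
`TailRatchet` is false — by name, through the registered stubs.
[cite: Tao2016AveragedNS, §4, §6.4; cell vocabulary (stmt-NavierStokesRegularity-21808)] -/
theorem tailRatchet_false_of_either (hF : DyadicScalarFronts ∨ ViscousBlockDSSWaves) : ¬ TailRatchet := by
  rcases hF with hF | hF
  · exact fun h => stubInviscid_false_of_DyadicScalarFronts hF (stubInviscid_of_tailRatchet h)
  · exact tailRatchet_false_of_ViscousBlockDSSWaves hF

end WakeRatchetBirthStubs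

end Summit.NavierStokesRegularity.NavierStokesRegularity.Theorems

end
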